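import Literature.MathematicalPhysics.QuantumFieldTheory.OSReconstructionNoE1
import Literature.MathematicalPhysics.QuantumLattice.SchwartzTranslationCutoff
import Literature.Analysis.FunctionSpaces.SchwartzFunctionalSubsequenceLimit
import HarnessLib

/-!
# Subsequential limits of Schwinger functions bounded on `⁰𝒮`, and inheritance of the OS axioms

Literature support file (theorems only, fully proved) for the "compactness + inheritance" step
of continuum-limit constructions of Euclidean field theories in the Osterwalder–Schrader
framework on `⁰𝒮` (OS II, CMP 42 (1975), §2 and §4; Glimm–Jaffe, *Quantum Physics*, §6.1 and
Part II): a sequence `S k` of one-field Schwinger families (lattice spacing `a_k → 0`, cutoff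
`k → ∞`, …) obeying the E0′ bound `‖S k n F‖ ≤ σₙ |F|_{mₙ}` for `F ∈ ⁰𝒮ₙ` UNIFORMLY in `k ≥ k₀(n)`
has a subsequence converging on every `⁰𝒮ₙ` to a Schwinger family `T` with the same bound, and
every OS property that holds exactly along the sequence and is "closed under pointwise limits on
`⁰𝒮`" is inherited by `T`.

* `⁰𝒮` is stable under the test-function operations of the axioms (general arity `n`):
  `isOffDiagonal_of_subsingleton` (`n ≤ 1`: `⁰𝒮ₙ = 𝒮`), `IsOffDiagonal.precomp`,
  `IsOffDiagonal.translateMulti`, `IsOffDiagonal.permTest`, `IsOffDiagonal.starTest`,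
  `IsOffDiagonal.thetaMulti`, `IsOffDiagonal.osAdjoint`, and
  `IsAppendTensorOf.isOffDiagonal_of_isTimeOrdered` (every witness of `ΘF* ⊗ G` with `F, G`
  time-ordered lies in `⁰𝒮`, via the tree's `isOffDiagonal_appendTensor_osAdjoint`);
* `exists_strictMono_schwingerFamily_tendsto` — the extraction (the tree's
  `SchwartzMap.exists_strictMono_forall_clm_tendsto_on_submodule` with `ι = ℕ`,
  `E n = (Fin n → E)`, `M n = ⁰𝒮ₙ`, seminorm set `Iic (mₙ, mₙ)` = the tree's `schwartzNorm mₙ`),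
  and `exists_strictMono_schwingerFamily_tendsto_of_linearGrowth` (`σₙ = α (n!)^β`,
  `mₙ = n s`: the limit has E0′, `HasLinearGrowth`);
* inheritance along `S j n F → T n F` (`F ∈ ⁰𝒮ₙ`): `hasLinearGrowth_of_norm_le`,
  `isNormalized_of_tendsto` (E0), `apply_eq_apply_of_tendsto` (any identity
  `S j n (A F) = S j n F` with `A ⁰𝒮ₙ ⊆ ⁰𝒮ₙ`, e.g. lattice symmetries), `isSymmetric_of_tendsto`
  (E3), `isHermitian_of_tendsto` (E0 hermiticity), `isReflectionPositive_of_tendsto` (E2);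
* `translateMulti_apply_eq_of_tendsto` — E1 (translations) of the limit from ASYMPTOTIC
  invariance along the sequence (`S j n (F(· - b j)) - S j n F → 0` with `b j → a`, e.g. lattice
  vectors at spacing `a_j → 0`), by the equicontinuity given by the uniform bound and the strong
  continuity of translations on `𝓢` (`continuous_translateMulti`); with `IsOffDiagonal.sub`.

Deliberately NOT here: the cluster property / mass gap (not closed under pointwise limits) and
the identification of the limit with moments of a measure.

References: Osterwalder–Schrader II, §2 (the spaces `⁰𝒮`, norms `|·|_m`, E0′) and §4;
Glimm–Jaffe 1987, §6.1. [cite: OsterwalderSchraderCMP1975, §2]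
-/

noncomputable section

open Filter ComplexConjugate
open _root_.Topology
open scoped SchwartzMap
open Literature.MathematicalPhysics.AQFT Literature.MathematicalPhysics.QuantumLattice

namespace Literature.MathematicalPhysics.QuantumFieldTheory

/-! ### `⁰𝒮` is stable under the test-function operations of the axioms -/

section OffDiagonal

variable {E : Type*} [NormedAddCommGroup E] [NormedSpace ℝ E] {n : ℕ}

/-- For `n ≤ 1` there are no pairs of distinct indices, so `⁰𝒮ₙ = 𝒮`: every test function is
off-diagonal (OS II §2: `⁰𝒮(ℝ^{d·0}) = ℂ`, `⁰𝒮(ℝ^d) = 𝒮(ℝ^d)`). [folklore] -/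
theorem isOffDiagonal_of_subsingleton [Subsingleton (Fin n)] (F : 𝓢((Fin n → E), ℂ)) :
    IsOffDiagonal F := by
  rintro x ⟨i, j, hij, -⟩
  exact absurd (Subsingleton.elim i j) hij

/-- **`⁰𝒮` is stable under linear changes of variables preserving the diagonals**: if `G = F ∘ g`
pointwise for a continuous linear automorphism `g` of `Eⁿ` mapping the coincidence locus into
itself and `F ∈ ⁰𝒮`, then `G ∈ ⁰𝒮` (chain rule for iterated derivatives,
`ContinuousLinearMap.iteratedFDeriv_comp_right`). [folklore] -/
theorem _root_.Literature.MathematicalPhysics.AQFT.IsOffDiagonal.precomp {F G : 𝓢((Fin n → E), ℂ)}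
    (hF : IsOffDiagonal F) (g : (Fin n → E) ≃L[ℝ] (Fin n → E))
    (hg : ∀ x ∈ coincidenceLocus n E, g x ∈ coincidenceLocus n E) (hG : ∀ x, G x = F (g x)) :
    IsOffDiagonal G := by
  intro x hx k
  have hfun : (G : (Fin n → E) → ℂ) = (F : (Fin n → E) → ℂ) ∘ g := funext hG
  have key := (g : (Fin n → E) →L[ℝ] (Fin n → E)).iteratedFDeriv_comp_right (F.smooth k) x
    (i := k) le_rfl
  simp only [ContinuousLinearEquiv.coe_coe] at key
  rw [hfun, key, hF _ (hg x hx) k]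
  ext v
  simp

/-- `⁰𝒮` is stable under diagonal translations `F ↦ F(· - a, …, · - a)`. [folklore] -/
theorem _root_.Literature.MathematicalPhysics.AQFT.IsOffDiagonal.translateMulti {F : 𝓢((Fin n → E), ℂ)}
    (hF : IsOffDiagonal F) (a : E) : IsOffDiagonal (translateMulti a F) := by
  intro x hx k
  have hfun : ((QuantumLattice.translateMulti a F : 𝓢((Fin n → E), ℂ)) : (Fin n → E) → ℂ) =
      fun y => F (y - fun _ => a) := by
    funext y
    rw [QuantumLattice.translateMulti_apply]
    rfl
  rw [hfun, iteratedFDeriv_comp_sub]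
  have hmem : (x - fun _ => a) ∈ coincidenceLocus n E := by
    obtain ⟨i, j, hij, hxij⟩ := hx
    exact ⟨i, j, hij, by simp [hxij]⟩
  exact hF _ hmem k

/-- `⁰𝒮` is stable under permutations of the arguments `F ↦ F(x_{σ 1}, …, x_{σ n})`. [folklore] -/
theorem _root_.Literature.MathematicalPhysics.AQFT.IsOffDiagonal.permTest {F : 𝓢((Fin n → E), ℂ)}
    (hF : IsOffDiagonal F) (σ : Equiv.Perm (Fin n)) : IsOffDiagonal (permTest σ F) :=
  hF.precomp (ContinuousLinearEquiv.piCongrLeft ℝ (fun _ : Fin n => E) σ.symm)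
    (fun x hx => by
      have hgx : (ContinuousLinearEquiv.piCongrLeft ℝ (fun _ : Fin n => E) σ.symm) x = x ∘ σ := by
        funext i
        simp [ContinuousLinearEquiv.piCongrLeft, Equiv.piCongrLeft_apply_eq_cast]
      rw [hgx]
      obtain ⟨i, j, hij, hxij⟩ := hx
      exact ⟨σ.symm i, σ.symm j, fun h => hij (σ.symm.injective h), by simp [hxij]⟩)
    (fun _ => rfl)

/-- `⁰𝒮` is stable under pointwise complex conjugation. [folklore] -/
theorem _root_.Literature.MathematicalPhysics.AQFT.IsOffDiagonal.starTest {F : 𝓢((Fin n → E), ℂ)}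
    (hF : IsOffDiagonal F) : IsOffDiagonal (starTest F) := by
  intro x hx k
  have hfun : ((QuantumLattice.starTest F : 𝓢((Fin n → E), ℂ)) : (Fin n → E) → ℂ) =
      (Complex.conjCLE : ℂ →L[ℝ] ℂ) ∘ (F : (Fin n → E) → ℂ) := by
    funext y
    simp [QuantumLattice.starTest_apply]
  rw [hfun, (Complex.conjCLE : ℂ →L[ℝ] ℂ).iteratedFDeriv_comp_left (F.smooth k).contDiffAt
    (i := k) le_rfl, hF x hx k]
  ext v
  simp

end OffDiagonal

section Time

variable {d : ℕ} [NeZero d] {n m : ℕ}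

/-- `⁰𝒮` is stable under the diagonal time reflection `Θ` (a linear change of variables
preserving the diagonals, `IsOffDiagonal.precomp`; the same one-line argument gives stability
under `linActMulti L` for any linear isometry `L`). [folklore] -/
theorem _root_.Literature.MathematicalPhysics.AQFT.IsOffDiagonal.thetaMulti
    {G : 𝓢((Fin n → EuclideanSpace ℝ (Fin d)), ℂ)} (hG : IsOffDiagonal G) :
    IsOffDiagonal (thetaMulti d G) :=
  hG.precomp
    (ContinuousLinearEquiv.piCongrRight fun _ : Fin n =>
      (timeReflection d).symm.toContinuousLinearEquiv)
    (fun x hx => by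
      obtain ⟨i, j, hij, hxij⟩ := hx
      exact ⟨i, j, hij, by simp [hxij]⟩)
    (fun _ => rfl)

/-- `⁰𝒮` is stable under the OS adjoint `F ↦ ΘF*` (reversal of the arguments, diagonal time
reflection and conjugation all preserve `⁰𝒮`). [folklore] -/
theorem _root_.Literature.MathematicalPhysics.AQFT.IsOffDiagonal.osAdjoint
    {F : 𝓢((Fin n → EuclideanSpace ℝ (Fin d)), ℂ)} (hF : IsOffDiagonal F) :
    IsOffDiagonal (osAdjoint F) :=
  ((hF.permTest _).thetaMulti).starTest

/-- **Reflection-positivity witnesses lie in `⁰𝒮`**: every witness `H` of the tensor product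
`ΘF* ⊗ G` (`IsAppendTensorOf H (osAdjoint F) G`) with `F`, `G` time-ordered is off-diagonal —
the arguments of `ΘF*` carry strictly negative, those of `G` strictly positive, pairwise distinct
times (OS 1973 §4; KQR 2021 §9). A witness is determined pointwise, hence equals the tree's
`(osAdjoint F).appendTensor G`, for which this is `isOffDiagonal_appendTensor_osAdjoint`. [folklore] -/
theorem _root_.Literature.MathematicalPhysics.QuantumLattice.IsAppendTensorOf.isOffDiagonal_of_isTimeOrdered
    {F : 𝓢((Fin n → EuclideanSpace ℝ (Fin d)), ℂ)} {G : 𝓢((Fin m → EuclideanSpace ℝ (Fin d)), ℂ)} {H : 𝓢((Fin (n + m) → EuclideanSpace ℝ (Fin d)), ℂ)}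
    (hH : IsAppendTensorOf H (osAdjoint F) G) (hF : IsTimeOrdered F) (hG : IsTimeOrdered G) :
    IsOffDiagonal H := by
  have hHeq : H = (osAdjoint F).appendTensor G := by
    ext x
    rw [hH x, SchwartzMap.appendTensor_apply]
  rw [hHeq]
  exact OSReconstructionNoE1.isOffDiagonal_appendTensor_osAdjoint hF hG

end Time

/-! ### The extraction: a subsequence converging on every `⁰𝒮ₙ` -/

section Extraction

variable {E : Type*} [NormedAddCommGroup E] [NormedSpace ℝ E] [FiniteDimensional ℝ E]

/-- **Subsequential limits of Schwinger families bounded on `⁰𝒮` uniformly along a sequence.**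
Let `S k` (`k : ℕ`) be one-field Schwinger families on `E` (finite-dimensional) such that for
every arity `n`, for all sufficiently large `k` and all `F ∈ ⁰𝒮ₙ`,
`‖S k n F‖ ≤ σ n · |F|_{m n}` (the E0′ bound of OS II §2, uniform in `k ≥ k₀(n)`; `σ n ≥ 0`).
Then there are a strictly increasing `φ` and a Schwinger family `T` with `S (φ j) n F → T n F`
for every `n` and every `F ∈ ⁰𝒮ₙ`, and `‖T n F‖ ≤ σ n · |F|_{m n}` for ALL `F` (the tree's
`SchwartzMap.exists_strictMono_forall_clm_tendsto_on_submodule`: diagonal extraction on countable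
dense subsets of the subspaces `⁰𝒮ₙ`, then Hahn–Banach). This is the compactness step of the
continuum limit in the OS framework (Glimm–Jaffe 1987, §6.1 and Part II; OS II §4).
[cite: OsterwalderSchraderCMP1975, §2] -/
theorem exists_strictMono_schwingerFamily_tendsto (S : ℕ → SchwingerFamily E) (σ : ℕ → ℝ)
    (m : ℕ → ℕ) (hσ : ∀ n, 0 ≤ σ n)
    (hb : ∀ n, ∀ᶠ k in atTop, ∀ F : 𝓢((Fin n → E), ℂ), IsOffDiagonal F →
      ‖S k n F‖ ≤ σ n * schwartzNorm (m n) F) :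
    ∃ (φ : ℕ → ℕ) (T : SchwingerFamily E), StrictMono φ ∧
      (∀ (n : ℕ) (F : 𝓢((Fin n → E), ℂ)), IsOffDiagonal F →
        Tendsto (fun j => S (φ j) n F) atTop (𝓝 (T n F))) ∧
      ∀ (n : ℕ) (F : 𝓢((Fin n → E), ℂ)), ‖T n F‖ ≤ σ n * schwartzNorm (m n) F := by
  let M : ∀ n : ℕ, Submodule ℂ 𝓢((Fin n → E), ℂ) := fun n =>
    { carrier := {F | IsOffDiagonal F}
      add_mem' := fun hF hG => hF.add hG
      zero_mem' := isOffDiagonal_zero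
      smul_mem' := @fun c G hG => hG.smul c }
  have hM : ∀ n (F : 𝓢((Fin n → E), ℂ)), F ∈ M n ↔ IsOffDiagonal F := fun _ _ => Iff.rfl
  obtain ⟨φ, T, hφ, hT, hTb⟩ :=
    Literature.Analysis.FunctionSpaces.SchwartzMap.exists_strictMono_forall_clm_tendsto_on_submodule
      (ι := ℕ) (E := fun n => Fin n → E) M S (fun n => Finset.Iic (m n, m n)) σ hσ
      fun n => (hb n).mono fun k hk θ hθ => hk θ ((hM n θ).1 hθ)
  exact ⟨φ, T, hφ, fun n F hF => hT n F ((hM n F).2 hF), fun n F => hTb n F⟩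

/-- The same with the E0′ constants of a `HasLinearGrowth` bound, `σ n = α (n!)^β`, `m n = n·s`:
the limit family `T` obeys `‖T n F‖ ≤ α (n!)^β |F|_{n s}` for all `F`, in particular
`T.toLabelled.HasLinearGrowth` (OS II §2, E0′). [cite: OsterwalderSchraderCMP1975, §2] -/
theorem exists_strictMono_schwingerFamily_tendsto_of_linearGrowth (S : ℕ → SchwingerFamily E)
    (s : ℕ) (α β : ℝ) (hα : 0 ≤ α)
    (hb : ∀ n, ∀ᶠ k in atTop, ∀ F : 𝓢((Fin n → E), ℂ), IsOffDiagonal F →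
      ‖S k n F‖ ≤ α * (n.factorial : ℝ) ^ β * schwartzNorm (n * s) F) :
    ∃ (φ : ℕ → ℕ) (T : SchwingerFamily E), StrictMono φ ∧
      (∀ (n : ℕ) (F : 𝓢((Fin n → E), ℂ)), IsOffDiagonal F →
        Tendsto (fun j => S (φ j) n F) atTop (𝓝 (T n F))) ∧
      T.toLabelled.HasLinearGrowth ∧
      ∀ (n : ℕ) (F : 𝓢((Fin n → E), ℂ)),
        ‖T n F‖ ≤ α * (n.factorial : ℝ) ^ β * schwartzNorm (n * s) F := by
  obtain ⟨φ, T, hφ, hT, hTb⟩ := exists_strictMono_schwingerFamily_tendsto S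
    (fun n => α * (n.factorial : ℝ) ^ β) (fun n => n * s) (fun n => by positivity) hb
  exact ⟨φ, T, hφ, hT, fun _ => ⟨s, α, β, fun n _ _ F _ => hTb n F⟩, hTb⟩

end Extraction

/-! ### Inheritance of the axioms along pointwise limits on `⁰𝒮` -/

section Inheritance

variable {E : Type*} [NormedAddCommGroup E] [NormedSpace ℝ E]
  {S : ℕ → SchwingerFamily E} {T : SchwingerFamily E}

/-- **E0′ from a bound**: `‖T n F‖ ≤ α (n!)^β |F|_{n s}` on `⁰𝒮` is `HasLinearGrowth` of the
one-field family (OS II §2). [cite: OsterwalderSchraderCMP1975, §2] -/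
theorem hasLinearGrowth_of_norm_le (T : SchwingerFamily E) (s : ℕ) (α β : ℝ)
    (h : ∀ (n : ℕ) (F : 𝓢((Fin n → E), ℂ)), IsOffDiagonal F →
      ‖T n F‖ ≤ α * (n.factorial : ℝ) ^ β * schwartzNorm (n * s) F) :
    T.toLabelled.HasLinearGrowth :=
  fun _ => ⟨s, α, β, fun n _ _ F hF => h n F hF⟩

/-- **E0 (normalisation) is inherited**: if `S j n F → T n F` on `⁰𝒮` and eventually
`S j 0 F = F()` then `T 0 F = F()` (`⁰𝒮₀ = 𝒮`). [folklore] -/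
theorem isNormalized_of_tendsto
    (hconv : ∀ (n : ℕ) (F : 𝓢((Fin n → E), ℂ)), IsOffDiagonal F →
      Tendsto (fun j => S j n F) atTop (𝓝 (T n F)))
    (h : ∀ᶠ j in atTop, (S j).toLabelled.IsNormalized) : T.toLabelled.IsNormalized := by
  intro k F
  refine tendsto_nhds_unique (hconv 0 F (isOffDiagonal_of_subsingleton F)) ?_
  exact tendsto_const_nhds.congr' (h.mono fun _ hj => (hj k F).symm)

/-- **Identities on `⁰𝒮` are inherited**: if `A` maps `⁰𝒮ₙ` into itself and eventually
`S j n (A F) = S j n F` for all `F ∈ ⁰𝒮ₙ` (e.g. invariance under a lattice symmetry, a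
permutation of the arguments, a hypercubic rotation), then `T n (A F) = T n F` on `⁰𝒮ₙ`.
[folklore] -/
theorem apply_eq_apply_of_tendsto {n : ℕ}
    (hconv : ∀ F : 𝓢((Fin n → E), ℂ), IsOffDiagonal F →
      Tendsto (fun j => S j n F) atTop (𝓝 (T n F)))
    (A : 𝓢((Fin n → E), ℂ) → 𝓢((Fin n → E), ℂ))
    (hA : ∀ F, IsOffDiagonal F → IsOffDiagonal (A F))
    (h : ∀ᶠ j in atTop, ∀ F : 𝓢((Fin n → E), ℂ), IsOffDiagonal F → S j n (A F) = S j n F)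
    (F : 𝓢((Fin n → E), ℂ)) (hF : IsOffDiagonal F) : T n (A F) = T n F :=
  tendsto_nhds_unique (hconv (A F) (hA F hF))
    ((hconv F hF).congr' (h.mono fun _ hj => (hj F hF).symm))

/-- **E3 (symmetry) is inherited** along pointwise limits on `⁰𝒮` (`permTest` preserves `⁰𝒮`).
[folklore] -/
theorem isSymmetric_of_tendsto
    (hconv : ∀ (n : ℕ) (F : 𝓢((Fin n → E), ℂ)), IsOffDiagonal F →
      Tendsto (fun j => S j n F) atTop (𝓝 (T n F)))
    (h : ∀ᶠ j in atTop, (S j).toLabelled.IsSymmetric) : T.toLabelled.IsSymmetric := by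
  intro n k π F hF
  exact apply_eq_apply_of_tendsto (hconv n) (permTest π) (fun G hG => hG.permTest π)
    (h.mono fun _ hj G hG => hj n k π G hG) F hF

variable {d : ℕ} [NeZero d]
  {S' : ℕ → SchwingerFamily (EuclideanSpace ℝ (Fin d))} {T' : SchwingerFamily (EuclideanSpace ℝ (Fin d))}

/-- **E0 (hermiticity) is inherited** along pointwise limits on `⁰𝒮`: time-ordered `F` and its
OS adjoint `ΘF*` both lie in `⁰𝒮`, and conjugation is continuous. [folklore] -/
theorem isHermitian_of_tendsto
    (hconv : ∀ (n : ℕ) (F : 𝓢((Fin n → EuclideanSpace ℝ (Fin d)), ℂ)), IsOffDiagonal F →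
      Tendsto (fun j => S' j n F) atTop (𝓝 (T' n F)))
    (h : ∀ᶠ j in atTop, (S' j).toLabelled.IsHermitian) : T'.toLabelled.IsHermitian := by
  intro n k F hF
  have hFo : IsOffDiagonal F := hF.isOffDiagonal
  refine tendsto_nhds_unique (hconv n F hFo) ?_
  have hadj := ((Complex.continuous_conj.tendsto _).comp (hconv n (osAdjoint F) hFo.osAdjoint))
  refine hadj.congr' (h.mono fun _ hj => ?_)
  exact (hj n k F hF).symm

/-- **E2 (reflection positivity) is inherited** along pointwise limits on `⁰𝒮`: every witness of
`ΘFᵢ* ⊗ Fⱼ` with time-ordered `Fᵢ, Fⱼ` lies in `⁰𝒮`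
(`IsAppendTensorOf.isOffDiagonal_of_isTimeOrdered`), the finite sums converge, and
`{z | 0 ≤ re z, im z = 0}` is closed (OS II §4: positivity survives the limit). [cite: OsterwalderSchraderCMP1975, §4] -/
theorem isReflectionPositive_of_tendsto
    (hconv : ∀ (n : ℕ) (F : 𝓢((Fin n → EuclideanSpace ℝ (Fin d)), ℂ)), IsOffDiagonal F →
      Tendsto (fun j => S' j n F) atTop (𝓝 (T' n F)))
    (h : ∀ᶠ j in atTop, (S' j).toLabelled.IsReflectionPositive) :
    T'.toLabelled.IsReflectionPositive := by
  intro N deg lab F hF H hH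
  dsimp only
  set z : ℂ := ∑ i, ∑ j, T' (deg i + deg j) (H i j) with hz_def
  have hz : Tendsto (fun l => ∑ i, ∑ j, S' l (deg i + deg j) (H i j)) atTop (𝓝 z) := by
    refine tendsto_finsetSum _ fun i _ => tendsto_finsetSum _ fun j _ => ?_
    exact hconv _ (H i j) ((hH i j).isOffDiagonal_of_isTimeOrdered (hF i) (hF j))
  have hev : ∀ᶠ l in atTop, 0 ≤ (∑ i, ∑ j, S' l (deg i + deg j) (H i j)).re ∧
      (∑ i, ∑ j, S' l (deg i + deg j) (H i j)).im = 0 :=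
    h.mono fun _ hl => hl N deg lab F hF H hH
  refine ⟨ge_of_tendsto ((Complex.continuous_re.tendsto _).comp hz) (hev.mono fun _ hl => hl.1),
    tendsto_nhds_unique ((Complex.continuous_im.tendsto _).comp hz) ?_⟩
  exact tendsto_const_nhds.congr' (hev.mono fun _ hl => hl.2.symm)

end Inheritance

/-! ### Translation invariance of the limit from asymptotic invariance along the sequence -/

section Translation

variable {E : Type*} [NormedAddCommGroup E] [NormedSpace ℝ E] {n : ℕ}
  {S : ℕ → SchwingerFamily E} {T : SchwingerFamily E}

/-- `⁰𝒮` is stable under subtraction. [folklore] -/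
theorem _root_.Literature.MathematicalPhysics.AQFT.IsOffDiagonal.sub {F G : 𝓢((Fin n → E), ℂ)}
    (hF : IsOffDiagonal F) (hG : IsOffDiagonal G) : IsOffDiagonal (F - G) := by
  rw [sub_eq_add_neg, ← neg_one_smul ℂ G]
  exact hF.add (hG.smul (-1))

/-- The translation orbit `a ↦ F(· - a, …, · - a)` of an `n`-point test function is continuous
`E → 𝓢(Eⁿ)` (strong continuity of translations on Schwartz space, the tree's
`continuous_compSubConstCLM`; Hörmander I §7.1). [folklore] -/
theorem continuous_translateMulti (F : 𝓢((Fin n → E), ℂ)) :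
    Continuous fun a : E => translateMulti a F :=
  (continuous_compSubConstCLM ℂ F).comp (continuous_pi fun _ => continuous_id)

/-- **Translation invariance of the limit from asymptotic invariance along the sequence.** Let
`S j n F → T n F` on `⁰𝒮ₙ` with the uniform bound `‖S j n F‖ ≤ σ |F|_m` (`F ∈ ⁰𝒮ₙ`, `j` large),
and let `b j → a` in `E` be vectors (e.g. lattice vectors at spacing `a_j → 0` approximating `a`)
under which `S j n` is asymptotically invariant on `⁰𝒮ₙ`:
`S j n (F(· - b j)) - S j n F → 0`. Then `T n (F(· - a)) = T n F` for `F ∈ ⁰𝒮ₙ` — by the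
equicontinuity `‖S j n (F(· - a) - F(· - b j))‖ ≤ σ |F(· - a) - F(· - b j)|_m → 0`
(`continuous_translateMulti`). This is how E1 (translations) of a continuum limit follows from
the lattice symmetry (Glimm–Jaffe 1987, §6.1; OS II §4). [folklore] -/
theorem translateMulti_apply_eq_of_tendsto
    (hconv : ∀ F : 𝓢((Fin n → E), ℂ), IsOffDiagonal F →
      Tendsto (fun j => S j n F) atTop (𝓝 (T n F)))
    {σ : ℝ} {m : ℕ}
    (hb : ∀ᶠ j in atTop, ∀ F : 𝓢((Fin n → E), ℂ), IsOffDiagonal F →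
      ‖S j n F‖ ≤ σ * schwartzNorm m F)
    {a : E} {b : ℕ → E} (hba : Tendsto b atTop (𝓝 a))
    (hinv : ∀ F : 𝓢((Fin n → E), ℂ), IsOffDiagonal F →
      Tendsto (fun j => S j n (translateMulti (b j) F) - S j n F) atTop (𝓝 0))
    (F : 𝓢((Fin n → E), ℂ)) (hF : IsOffDiagonal F) : T n (translateMulti a F) = T n F := by
  -- the translates `F(· - b j) → F(· - a)` in `𝓢`, hence in the norm `|·|_m`
  have hτ : Tendsto (fun j => translateMulti (b j) F) atTop (𝓝 (translateMulti a F)) :=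
    ((continuous_translateMulti F).tendsto a).comp hba
  have hqc : Continuous fun G : 𝓢((Fin n → E), ℂ) => schwartzNorm m G :=
    Seminorm.continuous_finsetSup (s := Finset.Iic (m, m)) fun i _ =>
      (schwartz_withSeminorms ℂ (Fin n → E) ℂ).continuous_seminorm i
  have h1 : Tendsto (fun j => translateMulti a F - translateMulti (b j) F) atTop (𝓝 0) := by
    simpa using (tendsto_const_nhds (x := translateMulti a F)).sub hτ
  have hN : Tendsto (fun j => schwartzNorm m (translateMulti a F - translateMulti (b j) F))
      atTop (𝓝 0) := by
    have h2 := (hqc.tendsto 0).comp h1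
    rwa [show schwartzNorm m (0 : 𝓢((Fin n → E), ℂ)) = 0 from map_zero _] at h2
  -- equicontinuity: `S j n (F(· - a)) - S j n (F(· - b j)) → 0`
  have h3 : Tendsto (fun j => S j n (translateMulti a F - translateMulti (b j) F)) atTop (𝓝 0) := by
    refine squeeze_zero_norm' (hb.mono fun j hj => hj _ ((hF.translateMulti a).sub
      (hF.translateMulti (b j)))) ?_
    simpa using hN.const_mul σ
  -- hence `S j n (F(· - a)) - S j n F → 0`
  have h4 : Tendsto (fun j => S j n (translateMulti a F) - S j n F) atTop (𝓝 0) := by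
    have h5 := h3.add (hinv F hF)
    rw [add_zero] at h5
    refine h5.congr' (Eventually.of_forall fun j => ?_)
    simp only [map_sub]
    ring
  have h6 : T n (translateMulti a F) - T n F = 0 :=
    tendsto_nhds_unique (((hconv _ (hF.translateMulti a)).sub (hconv F hF))) h4
  exact sub_eq_zero.1 h6

end Translation

end Literature.MathematicalPhysics.QuantumFieldTheory
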